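import Summits.BirchSwinnertonDyer.Rank1Residual.Additive.PotentiallyOrdinaryTypeG
import Summits.BirchSwinnertonDyer.Rank1Residual.Additive.CyclotomicPrimeReduction
import Literature.NumberTheory.EllipticCurves.HasseManin
import HarnessLib

/-!
# Defect-`4` (G)-pairs are NON-ANOMALOUS: `p ∤ #Ẽ(𝔽_p)` at every degree-one good place, `p ≥ 7`

HONEST FRAMING (cell `b2b-bsdres`, run/shared/lean/b2b/bsd-rank1-residual/, verbatim in every
file): the goal of the cell is to DELETE the COMBINATION-SHAPED residual classes of the
Birch–Swinnerton-Dyer formula for ALL analytic-rank `≤ 1` elliptic curves over `ℚ` — "full BSD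
formula for every rank `≤ 1` curve in class `C`" assembled STRICTLY from published theorems — so
that the rank-`≤ 1` remainder becomes exactly the CONSTRUCTION-SHAPED classes, which are TYPED
(missing-input `Prop`s), NOT attempted. This is not "finishing BSD". Sub-cell `additive-p2`
(X3♯(G-ord) / X4♯(G-ord)), generation 11: research route; no claim beyond the stated classes;
theorems only, no named fact, nothing booked, no label moved.

## What is proved

Mazur's *anomalous* condition at a good place `w` with residue field `𝔽_p` — `p ∣ #Ẽ_w(𝔽_p)`, i.e.
`a_w ≡ 1 (mod p)`; the factor `#Ẽ_v(k_v)_p` of Greenberg's Theorem 4.1 (LNM 1716), the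
"non-anomalous" hypothesis of every Euler-characteristic / control argument over a (G)-field — is
decided by the `j`-invariant alone for Kodaira types `III`, `III*` (semistability defect
`e_E(p) = 4`, `j̃ = 1728`):

* `SpecialJ.two_dvd_natCard_point_of_j_eq` — over any field of characteristic `p ≥ 5`, an elliptic
  curve with `j = 1728` has a rational point of order `2` (short model `y² = x³ + a₄x`, the point
  `(0, 0)`), so `2 ∣ #E(F)`;
* `SpecialJ.not_dvd_natCard_point_of_j_eq_of_natCard_eq` — over the PRIME field `𝔽_p`, `p ≥ 7`,
  `j(E) = 1728` ⟹ `p ∤ #E(𝔽_p)`: by Hasse (the tree's `HasseManin.abs_card_sub_le`, Manin's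
  elementary proof, here squared into `ℤ`: `sq_natCard_point_sub_le`) the interval
  `(p + 1 − 2√p, p + 1 + 2√p)` contains no EVEN multiple of `p` once `p ≥ 7`, and `#E = p` is odd;
* `not_dvd_natCard_point_reductionAt_of_valuation_j_sub_lt_one` — number fields: `V/F` good at a
  place `w` with `N(w) = p ≥ 7` and `w(j − 1728) < 1` ⟹ `p ∤ #Ṽ_w(k_w)`, equivalently the
  `p`-primary part of `Ṽ_w(k_w)` is trivial (`natCard_primaryComponent_point_reductionAt_eq_one`);
* **`not_dvd_natCard_point_reductionAt_of_semistabilityIndex_eq_four`** — the (G)-cell statement: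
  `W/ℚ` globally minimal, ADDITIVE at `p ≥ 7` with semistability defect `e_E(p) = 4` (Kodaira
  `III`/`III*`, `ord_p Δ_min ∈ {3, 9}`), `F` ANY number field, `w ∋ p` ANY place with `N(w) = p` at
  which `E_F` is good ⟹ `p ∤ #Ẽ_w(𝔽_p)`; hence at EVERY place above `p` of every subfield of
  `ℚ(ζ_p)` over which `E` is good there
  (`not_dvd_natCard_point_reductionAt_intermediateField_of_semistabilityIndex_eq_four`: all
  residue degrees above `p` are `1`, gen 3's `absNorm_eq_of_intermediateField_cyclotomic`) — every
  (G)-field, in particular the minimal (G)-field `F₀` (quartic) — and over `ℚ(ζ_p)` itself in the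
  currency `#Ẽ_𝔭(𝔽_p)[p^∞] = 1` of Greenberg's Thm. 4.1
  (`natCard_primaryComponent_point_reductionAt_cyclotomic_eq_one_of_semistabilityIndex_eq_four`).

Sharpness (remarks, not used): at `p = 5` the curve `y² = x³ − 2x` over `𝔽_5` has `10` points, so
anomalous defect-`4` places exist at `p = 5` (the only prime `≡ 1 (mod 4)` below `7`); over
`𝔽_{p²}` evenness does not help (`p = 17`: a quartic twist of `y² = x³ − x` over `𝔽_{289}` has
trace `−16` and `306 = 17·18` points), so the degree-one hypothesis is needed; for defects `3, 6`
(`j̃ = 0`) anomalous degree-one places DO occur (`p = 7, 19, 37, …`, exactly when `4p = 1 + 3m²`),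
and for defect `2` (`I₀*`) the reduction is that of the twist `E^{(p*)}`, anomalous iff
`a_p(E^{(p*)}) = 1` — a genuine datum; no analogue is claimed in those cells.

Use: the `2·ord_p #Ẽ(𝔽_p)[p]` term of the cell's line-V19-type inequalities over `F = ℚ(μ_p)`
(additive-p4, REPAIR-CENSUS V19; Greenberg Thm. 4.1 over `F`) VANISHES identically on the
defect-`4` sub-population of X3♯(G-ord) ∪ X4♯(G-ord) at `p ≥ 13`, as does the anomalous
obstruction of any future Euler-characteristic argument over a (G)-field for these pairs. Census
(hyp seat `hyp_bits.tsv`, `N < 2·10⁴`): `265` of the `1280` (G-ord) pairs have type `III/III*`;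
`32` of them lie at `p ≥ 13` (all X4, rank `0`: `p = 13`: 21, `17`: 7, `29`: 2, `37`: 1, `53`: 1)
and are covered; the other `233` lie at `p = 5`, where the anomalous bit is a genuine datum.

References: B. Mazur, Invent. Math. 18 (1972) 183–266 (anomalous primes); R. Greenberg, LNM 1716
(1999) Thm. 4.1; J. H. Silverman, *AEC* Thm. V.1.1 (Hasse), III.1–III.2 (short models, points of
order `2`), Ex. V.4.5; H. Hasse (1936); Ju. I. Manin (1956).
-/

noncomputable section

open scoped Classical NumberField

open WeierstrassCurve IsDedekindDomain NumberField IsLocalRing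

namespace Summit.BirchSwinnertonDyer.Rank1Residual.Additive

namespace SpecialJ

/-! ### A rational `2`-torsion point when `j = 1728` -/

section TwoTorsion

variable {F : Type*} [Field F] (E : WeierstrassCurve F)

/-- On a short Weierstrass model `y² = x³ + a₄ x` (`a₆ = 0`) of an elliptic curve, `(0, 0)` is a
rational point of order `2`; hence `2 ∣ #E(F)` (Lagrange; `Nat.card = 0` if `E(F)` is infinite).
Silverman *AEC* III.2.3. -/
theorem two_dvd_natCard_point_of_a₆_eq_zero [E.IsShortNF] [E.IsElliptic] (h6 : E.a₆ = 0) :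
    2 ∣ Nat.card E.toAffine.Point := by
  have ha4 : E.a₄ ≠ 0 := by
    intro h4
    have hΔ : E.Δ = 0 := by rw [E.Δ_of_isShortNF, h4, h6]; ring
    exact E.isUnit_Δ.ne_zero hΔ
  have hns : E.toAffine.Nonsingular 0 0 := by
    rw [Affine.nonsingular_zero]
    exact ⟨h6, Or.inr ha4⟩
  have h2P : addOrderOf (Affine.Point.some _ _ hns) = 2 := by
    haveI : Fact (Nat.Prime 2) := ⟨Nat.prime_two⟩
    refine addOrderOf_eq_prime ?_ (Affine.Point.some_ne_zero hns)
    rw [two_nsmul]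
    exact Affine.Point.add_self_of_Y_eq
      (by rw [Affine.negY, E.a₁_of_isShortNF, E.a₃_of_isShortNF]; ring)
  rw [← h2P]
  exact addOrderOf_dvd_natCard _

variable {p : ℕ}

/-- **`j = 1728` in characteristic `p ≥ 5` ⟹ a rational point of order `2` ⟹ `2 ∣ #E(F)`**:
bring `E` to short normal form (`E.toShortNF • E`, same points by the tree's
`VariableChange.pointEquiv`), where `j = 1728 ⟺ c₆ = 0 ⟺ a₆ = 0`. Silverman *AEC* III.1.4(c). -/
theorem two_dvd_natCard_point_of_j_eq [E.IsElliptic] (hchar : ringChar F = p) (hp5 : 5 ≤ p)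
    (hj : E.j = 1728) : 2 ∣ Nat.card E.toAffine.Point := by
  obtain ⟨h2, h3'⟩ := ringChar_ne_two_and_ne_three (F := F) hchar hp5
  obtain ⟨h2', h3''⟩ := two_ne_zero_and_three_ne_zero h2 h3'
  haveI : Invertible (2 : F) := invertibleOfNonzero h2'
  haveI : Invertible (3 : F) := invertibleOfNonzero h3''
  haveI : (E.toShortNF • E).IsShortNF := E.toShortNF_spec
  have hjS : (E.toShortNF • E).j = 1728 := by rw [variableChange_j, hj]
  have hc6 : (E.toShortNF • E).c₆ = 0 := (j_eq_iff_c₆_eq_zero _).mp hjS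
  have ha6 : (E.toShortNF • E).a₆ = 0 := by
    rw [(E.toShortNF • E).c₆_of_isShortNF] at hc6
    have h864 : (-864 : F) ≠ 0 := by
      rw [show (-864 : F) = -(2 ^ 5 * 3 ^ 3) by norm_num]
      exact neg_ne_zero.mpr (mul_ne_zero (pow_ne_zero _ h2') (pow_ne_zero _ h3''))
    exact (mul_eq_zero.mp hc6).resolve_left h864
  rw [Nat.card_congr (VariableChange.pointEquiv E E.toShortNF).toEquiv]
  exact two_dvd_natCard_point_of_a₆_eq_zero (E.toShortNF • E) ha6

end TwoTorsion

/-! ### The prime field: Hasse's bound excludes even multiples of `p ≥ 7` -/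

section PrimeField

variable {F : Type*} [Field F] [Fintype F] (E : WeierstrassCurve F) [E.IsElliptic]

/-- **Hasse in integers**: `(#E(F) − (q + 1))² ≤ 4q` (the tree's `HasseManin.abs_card_sub_le`,
Manin's elementary proof of Silverman *AEC* Thm. V.1.1, squared). -/
theorem sq_natCard_point_sub_le :
    ((Nat.card E.toAffine.Point : ℤ) - (Fintype.card F + 1)) ^ 2 ≤ 4 * Fintype.card F := by
  have h := Literature.NumberTheory.EllipticCurves.HasseManin.abs_card_sub_le E
  have hsq : ((Nat.card E.toAffine.Point : ℝ) - (Fintype.card F + 1)) ^ 2 ≤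
      (2 * Real.sqrt (Fintype.card F)) ^ 2 := by
    rw [← sq_abs]
    exact pow_le_pow_left₀ (abs_nonneg _) h 2
  rw [mul_pow, Real.sq_sqrt (Nat.cast_nonneg _)] at hsq
  have h' : (((Nat.card E.toAffine.Point : ℤ) - (Fintype.card F + 1)) ^ 2 : ℝ) ≤
      ((4 * Fintype.card F : ℤ) : ℝ) := by
    push_cast; linarith
  exact_mod_cast h'

end PrimeField

section NatCard

variable {k : Type*} [Field k] [Finite k] (E : WeierstrassCurve k) [E.IsElliptic] {p : ℕ}

/-- **Over `𝔽_p`, `p ≥ 7`, a curve with `j = 1728` is never anomalous: `p ∤ #E(𝔽_p)`.** `#E(𝔽_p)`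
is even (`two_dvd_natCard_point_of_j_eq`) and satisfies `(#E − p − 1)² ≤ 4p`; an even multiple
`N` of the odd prime `p` is `0` (excluded: `(p + 1)² > 4p`) or `≥ 2p` (excluded for `p ≥ 7`:
`(p − 1)² > 4p`). Sharp: `y² = x³ − 2x` over `𝔽_5` has `10` points. Silverman *AEC* V.1.1 with
Ex. V.4.5; Mazur 1972 (anomalous primes). -/
theorem not_dvd_natCard_point_of_j_eq_of_natCard_eq (hp : p.Prime) (hp7 : 7 ≤ p)
    (hcard : Nat.card k = p) (hj : E.j = 1728) : ¬ p ∣ Nat.card E.toAffine.Point := by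
  haveI := Fintype.ofFinite k
  haveI : Fact p.Prime := ⟨hp⟩
  obtain ⟨hchar, hq⟩ := ringChar_eq_of_natCard_eq (k := k) hp hcard
  intro hdvd
  have h2 : 2 ∣ Nat.card E.toAffine.Point := two_dvd_natCard_point_of_j_eq E hchar (by omega) hj
  have hsq := sq_natCard_point_sub_le E
  rw [hq] at hsq
  have hp2 : ¬ 2 ∣ p := by
    intro h
    have := (Nat.prime_dvd_prime_iff_eq Nat.prime_two hp).mp h
    omega
  -- `2p ∣ N`
  have h2p : 2 * p ∣ Nat.card E.toAffine.Point :=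
    Nat.Coprime.mul_dvd_of_dvd_of_dvd
      ((Nat.coprime_primes Nat.prime_two hp).mpr (by omega)) h2 hdvd
  obtain ⟨m, hm⟩ := h2p
  have hmZ : (Nat.card E.toAffine.Point : ℤ) = 2 * p * m := by exact_mod_cast hm
  rw [hmZ] at hsq
  have hp7Z : (7 : ℤ) ≤ p := by exact_mod_cast hp7
  rcases Nat.eq_zero_or_pos m with hm0 | hmpos
  · subst hm0
    nlinarith
  · have hm1 : (1 : ℤ) ≤ m := by exact_mod_cast hmpos
    have ht : (p : ℤ) - 1 ≤ 2 * p * m - (p + 1) := by nlinarith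
    have ht0 : (0 : ℤ) ≤ (p : ℤ) - 1 := by linarith
    have hsq' : ((p : ℤ) - 1) * ((p : ℤ) - 1) ≤ (2 * p * m - (p + 1)) ^ 2 := by
      rw [sq]; exact mul_le_mul ht ht ht0 (le_trans ht0 ht)
    nlinarith

/-- The same with the `p`-primary part: **`#E(𝔽_p)[p^∞]` is trivial** for `j = 1728`, `p ≥ 7`
(`Nat.card` of the `p`-primary component of the finite abelian group `E(𝔽_p)` is `1`). -/
theorem natCard_primaryComponent_point_eq_one_of_j_eq (hp : p.Prime) (hp7 : 7 ≤ p)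
    (hcard : Nat.card k = p) (hj : E.j = 1728) :
    Nat.card (AddCommGroup.primaryComponent E.toAffine.Point p) = 1 := by
  haveI : Fact p.Prime := ⟨hp⟩
  have hnd := not_dvd_natCard_point_of_j_eq_of_natCard_eq E hp hp7 hcard hj
  have hbot : AddCommGroup.primaryComponent E.toAffine.Point p = ⊥ := by
    refine (AddSubgroup.eq_bot_iff_forall _).mpr fun g hg ↦ ?_
    obtain ⟨n, hn⟩ := (AddCommGroup.mem_primaryComponent (G := E.toAffine.Point) (p := p)).mp hg
    have h1 : addOrderOf g ∣ p ^ n := addOrderOf_dvd_of_nsmul_eq_zero hn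
    have h2 : addOrderOf g ∣ Nat.card E.toAffine.Point := addOrderOf_dvd_natCard g
    have hcop : Nat.Coprime (p ^ n) (Nat.card E.toAffine.Point) :=
      Nat.Coprime.pow_left n ((Nat.Prime.coprime_iff_not_dvd hp).mpr hnd)
    have h3 : addOrderOf g ∣ 1 := by
      rw [← hcop.gcd_eq_one]
      exact Nat.dvd_gcd h1 h2
    exact AddMonoid.addOrderOf_eq_one_iff.mp (Nat.dvd_one.mp h3)
  rw [hbot, AddSubgroup.card_bot]

end NatCard

end SpecialJ

/-! ### Number fields: degree-one good places with `j ≡ 1728` -/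

section NumberFieldPlace

variable {F : Type} [Field F] [NumberField F] (V : WeierstrassCurve F) [V.IsElliptic]
  (w : HeightOneSpectrum (𝓞 F)) {p : ℕ}

/-- **Non-anomalous at a degree-one place with `j ≡ 1728`**: for `V/F` with good reduction at a
place `w` of residue field `𝔽_p` (`N(w) = p`), `p ≥ 7`, and `w(j(V) − 1728) < 1`, the reduced
curve has `j̃ = 1728` (`reductionAt_j_eq_of_valuation_lt_one`, gen 3) and `p ∤ #Ṽ_w(k_w)`
(`SpecialJ.not_dvd_natCard_point_of_j_eq_of_natCard_eq`). Mazur 1972; Silverman *AEC* V.1.1. -/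
theorem not_dvd_natCard_point_reductionAt_of_valuation_j_sub_lt_one (hp : p.Prime) (hp7 : 7 ≤ p)
    (hN : Ideal.absNorm w.asIdeal = p) (hgood : V.HasGoodReductionAt w)
    (hj : w.valuation F (V.j - 1728) < 1) :
    ¬ p ∣ Nat.card (V.reductionAt w).toAffine.Point := by
  haveI : (V.reductionAt w).IsElliptic := isElliptic_reductionAt hgood
  exact SpecialJ.not_dvd_natCard_point_of_j_eq_of_natCard_eq (V.reductionAt w) hp hp7
    (natCard_residueField_adicCompletionIntegers_eq_of_absNorm w hN)
    (reductionAt_j_eq_of_valuation_lt_one V w hgood hj)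

/-- The same in the currency of Greenberg's Theorem 4.1 (`#Ẽ_v(k_v)_p`, the `p`-primary part):
at a degree-one good place with `j ≡ 1728`, `p ≥ 7`, **`#Ẽ_w(k_w)[p^∞] = 1`**. -/
theorem natCard_primaryComponent_point_reductionAt_eq_one_of_valuation_j_sub_lt_one (hp : p.Prime)
    (hp7 : 7 ≤ p) (hN : Ideal.absNorm w.asIdeal = p) (hgood : V.HasGoodReductionAt w)
    (hj : w.valuation F (V.j - 1728) < 1) :
    Nat.card (AddCommGroup.primaryComponent (V.reductionAt w).toAffine.Point p) = 1 := by
  haveI : (V.reductionAt w).IsElliptic := isElliptic_reductionAt hgood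
  exact SpecialJ.natCard_primaryComponent_point_eq_one_of_j_eq (V.reductionAt w) hp hp7
    (natCard_residueField_adicCompletionIntegers_eq_of_absNorm w hN)
    (reductionAt_j_eq_of_valuation_lt_one V w hgood hj)

end NumberFieldPlace

/-! ### The (G)-cell: semistability defect `4` (Kodaira `III`, `III*`) -/

section Gord

variable (W : WeierstrassCurve ℚ) [W.IsElliptic] [W.IsGloballyMinimal] (p : ℕ) [hp : Fact p.Prime]

/-- **Defect `4` upstairs means `j ≡ 1728`.** For `W/ℚ` globally minimal with semistability
defect `e_E(p) = 4` at `p ≥ 5` and a place `w ∋ p` of a number field `F` at which `E_F` is good: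
`w(j(E) − 1728) < 1` (good reduction upstairs gives `ord_p j ≥ 0`,
`padicValRat_j_nonneg_of_hasGoodReductionAt_baseChange`, gen 9; `e = 4` gives `2 ∤ ord_p Δ_min`,
hence `j = 1728` or `ord_p (j − 1728) > 0`, `j_eq_or_padicValRat_j_sub_pos_of_not_two_dvd`, gen 3).
The reduction at `w` therefore has `j̃ = 1728` (Kodaira `III`/`III*`; Silverman *AEC* VII.6,
Table 4.1 of *ATAEC* IV.9). -/
theorem valuation_j_sub_lt_one_of_semistabilityIndex_eq_four (hp5 : 5 ≤ p)
    (he : semistabilityIndex W p = 4) {F : Type*} [Field F] [NumberField F]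
    {w : HeightOneSpectrum (𝓞 F)} (hw : (p : 𝓞 F) ∈ w.asIdeal)
    (hgood : (W.baseChange F).HasGoodReductionAt w) :
    w.valuation F ((W.baseChange F).j - 1728) < 1 := by
  haveI : (W.baseChange F).IsElliptic := by rw [baseChange]; infer_instance
  have hj : 0 ≤ padicValRat p W.j :=
    padicValRat_j_nonneg_of_hasGoodReductionAt_baseChange W p hw hgood
  have hjF : (W.baseChange F).j = algebraMap ℚ F W.j := W.map_j (algebraMap ℚ F)
  have h2v : ¬ 2 ∣ padicValInt p W.minimalDiscriminantInt := by
    intro h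
    have h46 : 4 ∣ 6 := he ▸ semistabilityIndex_dvd_six_of_two_dvd W p h
    omega
  have hj0 := j_eq_or_padicValRat_j_sub_pos_of_not_two_dvd W p hp5 hj h2v
  have h1728 : (W.baseChange F).j - 1728 = algebraMap ℚ F (W.j - 1728) := by
    rw [map_sub, hjF, map_ofNat]
  rw [h1728]
  exact valuation_algebraMap_lt_one_of_padicValRat_pos p w hw
    (hj0.imp (fun h ↦ sub_eq_zero.mpr h) id)

/-- **Defect-`4` additive pairs are non-anomalous at every degree-one good place above `p ≥ 7`.**
Let `W` be a globally minimal model of `E/ℚ` with semistability defect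
`e_E(p) = semistabilityIndex W p = 4` at `p ≥ 7` (i.e. `ord_p Δ_min ∈ {3, 9}`, Kodaira `III`/`III*`;
`E` is then additive at `p`). For ANY number field `F` and ANY place `w ∋ p` of `F` with residue
field `𝔽_p` (`N(w) = p`) at which `E_F` has good reduction, `p ∤ #Ẽ_w(𝔽_p)`:
`valuation_j_sub_lt_one_of_semistabilityIndex_eq_four` and the degree-one lemma. Mazur 1972;
Greenberg 1999 Thm. 4.1 (the hypothesis this discharges). -/
theorem not_dvd_natCard_point_reductionAt_of_semistabilityIndex_eq_four (hp7 : 7 ≤ p)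
    (he : semistabilityIndex W p = 4) {F : Type} [Field F] [NumberField F]
    {w : HeightOneSpectrum (𝓞 F)} (hw : (p : 𝓞 F) ∈ w.asIdeal) (hN : Ideal.absNorm w.asIdeal = p)
    (hgood : (W.baseChange F).HasGoodReductionAt w) :
    ¬ p ∣ Nat.card ((W.baseChange F).reductionAt w).toAffine.Point :=
  haveI : (W.baseChange F).IsElliptic := by rw [baseChange]; infer_instance
  not_dvd_natCard_point_reductionAt_of_valuation_j_sub_lt_one (W.baseChange F) w hp.out hp7 hN hgood
    (valuation_j_sub_lt_one_of_semistabilityIndex_eq_four W p (by omega) he hw hgood)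

/-- Greenberg's currency: for a defect-`4` pair and a degree-one good place `w ∋ p`, `p ≥ 7`,
**`#Ẽ_w(𝔽_p)[p^∞] = 1`**. -/
theorem natCard_primaryComponent_point_reductionAt_eq_one_of_semistabilityIndex_eq_four
    (hp7 : 7 ≤ p) (he : semistabilityIndex W p = 4) {F : Type} [Field F] [NumberField F]
    {w : HeightOneSpectrum (𝓞 F)} (hw : (p : 𝓞 F) ∈ w.asIdeal) (hN : Ideal.absNorm w.asIdeal = p)
    (hgood : (W.baseChange F).HasGoodReductionAt w) :
    Nat.card (AddCommGroup.primaryComponent ((W.baseChange F).reductionAt w).toAffine.Point p) = 1 :=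
  haveI : (W.baseChange F).IsElliptic := by rw [baseChange]; infer_instance
  natCard_primaryComponent_point_reductionAt_eq_one_of_valuation_j_sub_lt_one (W.baseChange F) w
    hp.out hp7 hN hgood (valuation_j_sub_lt_one_of_semistabilityIndex_eq_four W p (by omega) he hw hgood)

/-- **On the (G)-cell, defect `4`: non-anomalous at EVERY place above `p` of every (G)-field inside
`ℚ(ζ_p)`** (`p ≥ 7`; in fact `p ≡ 1 (mod 4)`, so `p ≥ 13`). In a subfield `F ⊆ ℚ(ζ_p)` every place
above `p` has residue degree `1` (`absNorm_eq_of_intermediateField_cyclotomic`, gen 3), so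
`not_dvd_natCard_point_reductionAt_of_semistabilityIndex_eq_four` applies at each place of good
reduction above `p` — at all of them when `F` is a (G)-field for `(E, p)` (Delbourgo 1998 §1.5 (G)).
In particular over the minimal (G)-field `F₀` (the quartic subfield of `ℚ(ζ_p)`, gen 5) and over
`ℚ(ζ_p)`. -/
theorem not_dvd_natCard_point_reductionAt_intermediateField_of_semistabilityIndex_eq_four
    (hp7 : 7 ≤ p) (he : semistabilityIndex W p = 4) {L : Type} [Field L] [NumberField L]
    [IsCyclotomicExtension {p} ℚ L] (F : IntermediateField ℚ L) (w : HeightOneSpectrum (𝓞 F))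
    (hw : (p : 𝓞 F) ∈ w.asIdeal) (hgood : (W.baseChange F).HasGoodReductionAt w) :
    ¬ p ∣ Nat.card ((W.baseChange F).reductionAt w).toAffine.Point := by
  haveI : NumberField F := NumberField.of_module_finite ℚ F
  haveI : w.asIdeal.LiesOver (Ideal.span {(p : ℤ)}) := Ideal.liesOver_span_of_natCast_mem' hp.out hw
  exact not_dvd_natCard_point_reductionAt_of_semistabilityIndex_eq_four W p hp7 he hw
    (absNorm_eq_of_intermediateField_cyclotomic p F w) hgood

/-- **Over `K = ℚ(ζ_p)` itself** (`IsCyclotomicExtension {p} ℚ K`; the field of the cell's line V19):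
for a defect-`4` pair at `p ≥ 7` and any place `𝔭 ∋ p` of `K` (there is exactly one, of norm `p`:
additive-p4's `exists_prime_over_prime`) at which `E_K` is good, `p ∤ #Ẽ_𝔭(𝔽_p)` and
`#Ẽ_𝔭(𝔽_p)[p^∞] = 1` — the anomalous factor of Greenberg's Thm. 4.1 over `K` is trivial. -/
theorem natCard_primaryComponent_point_reductionAt_cyclotomic_eq_one_of_semistabilityIndex_eq_four
    (hp7 : 7 ≤ p) (he : semistabilityIndex W p = 4) {K : Type} [Field K] [NumberField K]
    [IsCyclotomicExtension {p} ℚ K] {𝔭 : HeightOneSpectrum (𝓞 K)} (h𝔭 : (p : 𝓞 K) ∈ 𝔭.asIdeal)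
    (hgood : (W.baseChange K).HasGoodReductionAt 𝔭) :
    ¬ p ∣ Nat.card ((W.baseChange K).reductionAt 𝔭).toAffine.Point ∧
      Nat.card (AddCommGroup.primaryComponent ((W.baseChange K).reductionAt 𝔭).toAffine.Point p)
        = 1 := by
  obtain ⟨𝔭₀, -, huniq, hN⟩ := exists_prime_over_prime p K
  have h𝔭₀ : 𝔭 = 𝔭₀ := by
    have : 𝔭 ∈ ({𝔭₀} : Set (HeightOneSpectrum (𝓞 K))) := by
      rw [← huniq]; exact_mod_cast h𝔭
    exact this
  subst h𝔭₀
  exact ⟨not_dvd_natCard_point_reductionAt_of_semistabilityIndex_eq_four W p hp7 he h𝔭 hN hgood,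
    natCard_primaryComponent_point_reductionAt_eq_one_of_semistabilityIndex_eq_four W p hp7 he h𝔭 hN
      hgood⟩

end Gord

end Summit.BirchSwinnertonDyer.Rank1Residual.Additive

end
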